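import Literature.Topology.FourManifolds.GluingProofs
import Literature.Topology.FourManifolds.OneManifoldCircle
import Literature.Topology.FourManifolds.BoundaryOrientation
import Literature.Topology.FourManifolds.SliceGenusZeroProofs
import Mathlib.Analysis.InnerProductSpace.EuclideanDist
import HarnessLib

/-!
# Capping a compact surface with one boundary circle by a disc

Topic `Literature/Topology/FourManifolds`; fact seat
`provefact-Literature.Topology.FourManifolds.Knot.sliceGenus_eq_zero_iff`, towards its leaf
`Literature.Topology.FourManifolds.even_finrank_singularHomology_one_of_boundary_circle`
(`SurfaceGenusParity.lean`; the parity clause of Hirsch, *Differential Topology* (1976), Ch. 9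
§3, Thm. 3.7, for one boundary circle).  The bordered case is reduced to the closed case
(`even_finrank_singularHomology_one_of_orientation`, `SurfaceFirstBettiEven.lean`) by the
classical device of **capping the boundary circle with a disc** (Hirsch, Ch. 9 §3, proof of
Thm. 3.7: "attach disks to `∂M` to get a closed surface"; Massey, *A Basic Course in Algebraic
Topology* (1991), Ch. I §10).  This file constructs the capped surface:

* `nonempty_diffeomorph_boundary_sphere_one` — **the boundary of a compact orientable smooth
  surface whose boundary is homeomorphic to a circle is diffeomorphic to the circle**: it is a
  compact connected orientable smooth `1`-manifold (`isOrientable_boundary`), hence a circle by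
  the classification of compact `1`-manifolds in the tree's oriented form
  (`nonempty_diffeomorph_sphere_one_of_smoothOrientation`, Milnor, *Topology from the
  Differentiable Viewpoint* (1965), Appendix); likewise for the disc `𝔻²`;
* `CapData S` — a choice of boundary diffeomorphisms `∂S ≅ 𝕊¹ ≅ ∂𝔻²` and long open collars,
  non-vacuous (`CapData.nonempty`) under the hypotheses of the leaf;
* `CapData.P` — **the capped surface `S ∪_φ 𝔻²`**, the gluing of `S` and the disc along
  `φ : ∂S ≅ ∂𝔻²` by the tree's construction `BoundaryGlueData` (Milnor, *Lectures on the
  h-cobordism theorem* (1965), Thm. 1.4; `BoundaryGluingConstruction.lean`): a compact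
  Hausdorff second-countable `C^∞` surface without boundary (charts on `ℝ²`), with the smooth
  embeddings `jS : S → P`, `jD : 𝔻² → P` covering it and meeting along the seam; it is connected.

Everything is proved; no named facts are introduced.

## References

* M. W. Hirsch, *Differential Topology*, GTM 33 (1976), Ch. 9 §3, Thm. 3.7 and its proof.
  [HirschDT1976]
* J. Milnor, *Lectures on the h-cobordism theorem* (1965), §1, Thm. 1.4. [MilnorHCobordism1965]
* J. Milnor, *Topology from the Differentiable Viewpoint* (1965), Appendix. [MilnorTDV1965]
-/

noncomputable section

open Set Function
open scoped Manifold ContDiff Topology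

namespace Literature.Topology.FourManifolds

/-- Local notation: `𝔼 n` is the model Euclidean space `EuclideanSpace ℝ (Fin n)`. -/
local notation "𝔼 " n:arg => EuclideanSpace ℝ (Fin n)

/-- Local notation: `𝕊 n` is the unit sphere in `EuclideanSpace ℝ (Fin (n + 1))`. -/
local notation "𝕊 " n:arg => (Metric.sphere (0 : EuclideanSpace ℝ (Fin (n + 1))) 1)

/-- Local notation: `𝔻 n` is the closed unit ball in `EuclideanSpace ℝ (Fin n)`, with the
manifold-with-boundary structure `instChartedSpaceClosedBall` (model `𝓡∂ n`). -/
local notation "𝔻 " n:arg => (Metric.closedBall (0 : EuclideanSpace ℝ (Fin n)) 1)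

/-! ### The boundary circle -/

section BoundaryCircle

/-- The circle is connected. [folklore] -/
theorem connectedSpace_sphere_one : ConnectedSpace (𝕊 1) :=
  isConnected_iff_connectedSpace.1 (isConnected_sphere (by
    rw [← Module.finrank_eq_rank, finrank_euclideanSpace_fin]; norm_num) _ zero_le_one)

/-- A space homeomorphic to the circle is connected. [folklore] -/
theorem connectedSpace_of_homeomorph_sphere_one {X : Type*} [TopologicalSpace X] (e : X ≃ₜ 𝕊 1) :
    ConnectedSpace X := by
  haveI := connectedSpace_sphere_one
  refine connectedSpace_iff_univ.2 ?_
  have h := (isConnected_univ (α := 𝕊 1)).image e.symm e.symm.continuous.continuousOn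
  rwa [image_univ_of_surjective e.symm.surjective] at h

variable {S : Type*} [TopologicalSpace S] [ChartedSpace (EuclideanHalfSpace 2) S]

/-- The boundary of a compact `C^∞` manifold with boundary is compact (private copy of the
tree's `compactSpace_boundary`, `SPC4HandlesCancelStep.lean`, to keep the import closure small).
[folklore] -/
private theorem compactSpace_boundary_two [CompactSpace S] [IsManifold (𝓡∂ 2) ∞ S] :
    CompactSpace ((𝓡∂ 2).boundary S) :=
  isCompact_iff_compactSpace.1 (ModelWithCorners.isClosed_boundary (I := 𝓡∂ 2) (M := S)
    (n := ∞) (by simp)).isCompact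

/-- **The boundary circle of a compact orientable surface is diffeomorphic to `𝕊¹`**: a compact
connected orientable smooth `1`-manifold is a circle (Milnor, *Topology from the Differentiable
Viewpoint* (1965), Appendix; in the tree `nonempty_diffeomorph_sphere_one_of_smoothOrientation`),
and the boundary of an orientable `S` is orientable (`isOrientable_boundary`).
[cite: MilnorTDV1965, Appendix (Classifying one-manifolds)] -/
theorem nonempty_diffeomorph_boundary_sphere_one [T2Space S] [CompactSpace S]
    [IsManifold (𝓡∂ 2) ∞ S] (e : ↥((𝓡∂ 2).boundary S) ≃ₜ ↥(𝕊 1)) (ho : IsOrientable (𝓡∂ 2) S) :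
    Nonempty (↥((𝓡∂ 2).boundary S) ≃ₘ⟮𝓡 1, 𝓡 1⟯ ↥(𝕊 1)) := by
  haveI := compactSpace_boundary_two (S := S)
  haveI := connectedSpace_of_homeomorph_sphere_one e
  obtain ⟨o⟩ := isOrientable_boundary (n := 1) S ho
  exact nonempty_diffeomorph_sphere_one_of_smoothOrientation o

/-- **The boundary circle of the disc is diffeomorphic to `𝕊¹`** (same argument: `𝔻²` is
compact, its boundary is homeomorphic to `𝕊¹`, and it is orientable, being simply connected).
[cite: MilnorTDV1965, Appendix (Classifying one-manifolds)] -/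
theorem nonempty_diffeomorph_boundary_closedBall_sphere_one :
    Nonempty (↥((𝓡∂ 2).boundary (𝔻 2)) ≃ₘ⟮𝓡 1, 𝓡 1⟯ ↥(𝕊 1)) := by
  haveI : ContractibleSpace (𝔻 2) := Metric.contractibleSpace_closedBall zero_le_one
  obtain ⟨e, -⟩ := exists_homeomorph_boundary_closedBall 1
  exact nonempty_diffeomorph_boundary_sphere_one e isOrientable_of_simplyConnectedSpace_holds

end BoundaryCircle

/-! ### The capped surface -/

section Cap

variable (S : Type) [TopologicalSpace S] [T2Space S] [CompactSpace S]
  [ChartedSpace (EuclideanHalfSpace 2) S] [IsManifold (𝓡∂ 2) ∞ S]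

/-- **Capping data** for a compact smooth surface `S` with boundary: diffeomorphisms of `∂S` and
of `∂𝔻²` with the circle, and long open collars of both boundaries. [folklore] -/
structure CapData where
  /-- `∂S ≅ 𝕊¹`. -/
  φS : ↥((𝓡∂ 2).boundary S) ≃ₘ⟮𝓡 1, 𝓡 1⟯ ↥(𝕊 1)
  /-- `∂𝔻² ≅ 𝕊¹`. -/
  φD : ↥((𝓡∂ 2).boundary (𝔻 2)) ≃ₘ⟮𝓡 1, 𝓡 1⟯ ↥(𝕊 1)
  /-- A long open collar of `∂S`. -/
  CS : (BoundaryManifold.boundaryData 1 S).OpenCollar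
  /-- A long open collar of `∂𝔻²`. -/
  CD : (BoundaryManifold.boundaryData 1 (𝔻 2)).OpenCollar

variable {S} in
/-- **Capping data exist** for a compact orientable smooth surface whose boundary is homeomorphic
to the circle (boundary circles are circles, `nonempty_diffeomorph_boundary_sphere_one`; long
open collars exist, `BoundaryData.nonempty_openCollar`). [folklore] -/
theorem CapData.nonempty (e : ↥((𝓡∂ 2).boundary S) ≃ₜ ↥(𝕊 1)) (ho : IsOrientable (𝓡∂ 2) S) :
    Nonempty (CapData S) := by
  obtain ⟨φS⟩ := nonempty_diffeomorph_boundary_sphere_one e ho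
  obtain ⟨φD⟩ := nonempty_diffeomorph_boundary_closedBall_sphere_one
  haveI : Nonempty (BoundaryManifold.boundaryData 1 S).carrier := ⟨φS.symm (circlePoint 0)⟩
  haveI : Nonempty (BoundaryManifold.boundaryData 1 (𝔻 2)).carrier := ⟨φD.symm (circlePoint 0)⟩
  obtain ⟨CS⟩ := (BoundaryManifold.boundaryData 1 S).nonempty_openCollar
  obtain ⟨CD⟩ := (BoundaryManifold.boundaryData 1 (𝔻 2)).nonempty_openCollar
  exact ⟨⟨φS, φD, CS, CD⟩⟩

/-- A nonempty boundary gives a nonempty carrier of the boundary datum (instance form consumed by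
the gluing construction). [folklore] -/
instance nonempty_boundaryData_carrier [Nonempty ((𝓡∂ 2).boundary S)] :
    Nonempty (BoundaryManifold.boundaryData 1 S).carrier := ‹_›

/-- The boundary circle of the disc is nonempty. [folklore] -/
instance nonempty_boundaryData_closedBall_carrier :
    Nonempty (BoundaryManifold.boundaryData 1 (𝔻 2)).carrier :=
  ⟨(exists_homeomorph_boundary_closedBall 1).choose.symm (circlePoint 0)⟩

namespace CapData

variable {S} (c : CapData S) [Nonempty ((𝓡∂ 2).boundary S)]

/-- The gluing diffeomorphism `φ : ∂S ≅ ∂𝔻²` (through the circle). [folklore] -/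
def φ : (BoundaryManifold.boundaryData 1 S).carrier ≃ₘ⟮𝓡 1, 𝓡 1⟯
    (BoundaryManifold.boundaryData 1 (𝔻 2)).carrier :=
  c.φS.trans c.φD.symm

/-- The boundary gluing datum `(collar of S, collar of 𝔻², φ)`. [folklore] -/
def G : BoundaryGlueData (BoundaryManifold.boundaryData 1 S)
    (BoundaryManifold.boundaryData 1 (𝔻 2)) :=
  ⟨c.CS, c.CD, c.φ⟩

/-- **The capped surface** `P = S ∪_φ 𝔻²` (Milnor 1965, Thm. 1.4; Hirsch, Ch. 9 §3): a compact
Hausdorff second-countable smooth surface without boundary. [cite: MilnorHCobordism1965, §1 Thm. 1.4] -/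
abbrev P : Type := c.G.d₂.Glued

/-- The piece `S` of the capped surface. [folklore] -/
abbrev jS : S → c.P := c.G.jM

/-- The piece `𝔻²` of the capped surface. [folklore] -/
abbrev jD : (𝔻 2) → c.P := c.G.jN

/-- `jS` is a smooth embedding. [folklore] -/
theorem isSmoothEmbedding_jS : Manifold.IsSmoothEmbedding (𝓡∂ 2) 𝓘(ℝ, 𝔼 2) ∞ c.jS :=
  c.G.isSmoothEmbedding_jM

omit [CompactSpace S] in
/-- `jD` is a smooth embedding. [folklore] -/
theorem isSmoothEmbedding_jD : Manifold.IsSmoothEmbedding (𝓡∂ 2) 𝓘(ℝ, 𝔼 2) ∞ c.jD :=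
  c.G.isSmoothEmbedding_jN

omit [T2Space S] [CompactSpace S] in
/-- The two pieces cover the capped surface. [folklore] -/
theorem range_jS_union_range_jD : range c.jS ∪ range c.jD = univ :=
  c.G.range_jM_union_range_jN

omit [T2Space S] [CompactSpace S] in
/-- The two pieces meet: a boundary point of `S` is glued to the corresponding boundary point of
the disc. [folklore] -/
theorem jS_boundary_eq_jD (z : (𝓡∂ 2).boundary S) :
    c.jS z = c.jD ((BoundaryManifold.boundaryData 1 (𝔻 2)).incl (c.φ z)) := by
  have h1 := c.G.jM_incl z
  have h2 := c.G.jN_incl (c.φ z)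
  simp only [BoundaryManifold.boundaryData_incl] at h1 h2
  rw [show c.G.φ = c.φ from rfl, Diffeomorph.symm_apply_apply] at h2
  exact h1.trans h2.symm

omit [T2Space S] [CompactSpace S] in
/-- **The capped surface of a connected surface with nonempty boundary is connected** (the two
connected pieces `jS(S)`, `jD(𝔻²)` meet along the seam). [folklore] -/
theorem connectedSpace_P [ConnectedSpace S] : ConnectedSpace c.P := by
  haveI : ConnectedSpace (𝔻 2) := isConnected_iff_connectedSpace.1
    ((convex_closedBall (0 : 𝔼 2) 1).isPathConnected ⟨0, by simp⟩).isConnected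
  refine connectedSpace_iff_univ.2 ?_
  rw [← c.range_jS_union_range_jD]
  obtain ⟨z⟩ := (inferInstance : Nonempty ((𝓡∂ 2).boundary S))
  refine IsConnected.union ⟨c.jS z, mem_range_self _, ?_⟩
    (isConnected_range c.G.continuous_jM) (isConnected_range c.G.continuous_jN)
  rw [c.jS_boundary_eq_jD z]
  exact mem_range_self _

end CapData

end Cap

end Literature.Topology.FourManifolds
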